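import Summits.Ventures.YMGap.Thresholds.PressureThirdDerivative
import Summits.Ventures.YMGap.Thresholds.PressureTwoSidedC2
import HarnessLib

/-!
# `f ∈ C³` on the whole two-sided strong-coupling window `|β_W| < 9/25`, through `β = 0`, with `f'''(0) = 0`: the
# connected three-point function of the plaquette field VANISHES at `β = 0` (row type C-PRESS3, part 2)

Cell `pub-ymgap`, seat ds-1 (gen 10). HONEST FRAMING: strong-coupling LATTICE statements for `SU(2)` Wilson lattice gauge
theory on `ℤ⁴` about the infinite-volume free energy density `f = freeEnergyDensity 4 ρ_{SU(2)}` (tree coupling `β`, Wilson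
`β_W = 2β`); `C³` regularity through `β = 0` and the exact value `f'''(0) = 0` — NOT analyticity; the window `|β| < 9/50` is
where the vertex-star Dobrushin bound closes, not a transition; nothing about the continuum or the Clay problem. 0 compute.

* `su2_map_flip_eq_of_mem_zero` — at `β = 0` THE DLR state is invariant under the staggered centre flip (ds-3's
  `SignFlip.flip`, which negates EVERY plaquette): `𝒢(0) ∘ flip⁻¹ ⊆ 𝒢(-0) = 𝒢(0)` is a singleton;
* `su2_integral_plaquette_triple_zero`, ★ `su2_threePoint_zero` — hence every ODD plaquette moment vanishes at `β = 0`, in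
  particular `⟨W_p W_q W_r⟩₀ = 0` and the connected three-point function `u₃(W_p; W_q; W_r)₀ = 0` for ALL `p, q, r` (no
  combinatorics of shared links needed); `su2_thirdResponse_zero` — the third response `Σ_{i<j} 8 Σ_q Σ_r u₃` is `0` at `β = 0`;
* ★★ `su2_hasDerivAt_deriv_deriv_freeEnergyDensity_zero` — **`f'''(0) = 0` TWO-SIDED**: `f''` is differentiable AT `β = 0`
  with derivative `0` (right derivative `= Σ 8 ΣΣ u₃ = 0` by continuity of `f'''` on `[0, 9/50]`, part 1; left derivative by the
  evenness `f''(-β) = f''(β)` of g9's part 8) — the cubic Taylor coefficient of the free energy at infinite temperature vanishes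
  (`g(β_W) = -6β_W + (3/4)β_W² + 0·β_W³ + o(β_W³)`, consistent with Balian–Drouffe–Itzykson);
* `su2_hasDerivAt_deriv_deriv_freeEnergyDensity_of_neg` — `f'''(-β) = -f'''(β)` on the window;
* ★★ `su2_contDiffOn_three_freeEnergyDensity_abs : ContDiffOn ℝ 3 f (Ioo (-9/50) (9/50))` and the Wilson-normalised
  `su2_wilson_contDiffOn_three_abs` (`|β_W| < 9/25`): NO TRANSITION OF ORDER ≤ 3 anywhere in the two-sided window.

References: Balian–Drouffe–Itzykson, Phys. Rev. D 11 (1975) 2104 (strong-coupling series); Kogut–Susskind 1975 (staggered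
phases); H.-O. Georgii (2011) §5.1. All inputs are tree theorems.
-/

noncomputable section

open MeasureTheory ProbabilityTheory Set Filter Topology
open scoped NNReal
open Literature.MathematicalPhysics.QuantumLattice (LGConfig ZdEdge ZdPlaquette fundamentalRep ymGibbsMeasures
  ymSpecification plaquetteEdges freeEnergyDensity)
open Literature.MathematicalPhysics.QuantumFieldTheory hiding ZdEdge
open Summit.Ventures.YMGap.SignFlip (flip flipEquiv coe_flipEquiv plaquetteObs_flip isGibbsMeasure_map_flip measurable_flip)

namespace Summit.Ventures.YMGap.PressureRegularity

section ZeroFlip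

/-- Local shorthand: the normalised plaquette observable `W_q = ½ Re tr U_q` of `SU(2)` on `ℤ⁴`. -/
local notation3 (prettyPrint := false) "W∗" q:max =>
  zdPlaquetteObs (d := 4) (fundamentalRep (Fin 2)) (Prod.fst q) (Prod.snd q).1.1 (Prod.snd q).1.2

/-- **At `β = 0` the DLR state is flip-invariant**: for `ν ∈ 𝒢(0)` (`SU(2)`, `d = 4`), `ν ∘ flip⁻¹ = ν` — the image is a
DLR state at `-0 = 0` (`isGibbsMeasure_map_flip`) and `𝒢(0)` is a singleton (`su2_subsingleton_ymGibbsMeasures`). -/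
theorem su2_map_flip_eq_of_mem_zero {ν : Measure (LGConfig 4 (Matrix.specialUnitaryGroup (Fin 2) ℂ))}
    (hν : ν ∈ ymGibbsMeasures (d := 4) (fundamentalRep (Fin 2)) 0) : ν.map flip = ν := by
  have h := isGibbsMeasure_map_flip (d := 4) (β := 0) hν
  rw [neg_zero] at h
  exact su2_subsingleton_ymGibbsMeasures ⟨le_rfl, by norm_num⟩ h hν

/-- The normalised plaquette observable flips sign under the staggered centre flip: `W_q(flip U) = -W_q(U)`. -/
theorem su2_zdPlaquetteObs_flip (q : ZdPlaquette 4) (U : LGConfig 4 (Matrix.specialUnitaryGroup (Fin 2) ℂ)) :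
    (W∗ q) (flip U) = -(W∗ q) U := by
  have h := plaquetteObs_flip U q.1 (ne_of_lt q.2.2)
  rw [CouplingResponse.plaquetteObs_fundamentalRep_eq_mul_zdPlaquetteObs,
    CouplingResponse.plaquetteObs_fundamentalRep_eq_mul_zdPlaquetteObs] at h
  have h2 : ((2 : ℕ) : ℝ) * ((W∗ q) (flip U) + (W∗ q) U) = 0 := by rw [mul_add]; linarith
  have h3 : (W∗ q) (flip U) + (W∗ q) U = 0 := by
    rcases mul_eq_zero.1 h2 with h | h
    · norm_num at h
    · exact h
  linarith

/-- **Odd plaquette moments vanish at `β = 0`**: `∫ W_p W_q W_r dν = 0` for every `ν ∈ 𝒢(0)` and ALL plaquettes `p, q, r`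
(flip invariance of `ν` and `W ∘ flip = -W`). -/
theorem su2_integral_plaquette_triple_zero {ν : Measure (LGConfig 4 (Matrix.specialUnitaryGroup (Fin 2) ℂ))}
    (hν : ν ∈ ymGibbsMeasures (d := 4) (fundamentalRep (Fin 2)) 0) (p q r : ZdPlaquette 4) :
    ∫ U, (W∗ p) U * (W∗ q) U * (W∗ r) U ∂ν = 0 := by
  have h1 : ∫ U, (W∗ p) U * (W∗ q) U * (W∗ r) U ∂ν = ∫ U, (W∗ p) U * (W∗ q) U * (W∗ r) U ∂(ν.map flip) := by
    rw [su2_map_flip_eq_of_mem_zero hν]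
  have h2 : ∫ U, (W∗ p) U * (W∗ q) U * (W∗ r) U ∂(ν.map flip) =
      ∫ U, (W∗ p) (flip U) * (W∗ q) (flip U) * (W∗ r) (flip U) ∂ν := by
    rw [← coe_flipEquiv]
    exact integral_map_equiv flipEquiv _
  rw [h2] at h1
  simp only [su2_zdPlaquetteObs_flip] at h1
  have h3 : ∫ U, -(W∗ p) U * -(W∗ q) U * -(W∗ r) U ∂ν = -∫ U, (W∗ p) U * (W∗ q) U * (W∗ r) U ∂ν := by
    rw [← integral_neg]
    refine integral_congr_ae (ae_of_all _ fun U => ?_)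
    ring
  linarith

/-- ★ **THE CONNECTED THREE-POINT FUNCTION OF THE PLAQUETTE FIELD VANISHES AT `β = 0`**:
`u₃(W_p; W_q; W_r)_ν = 0` for every `ν ∈ 𝒢(0)` and all plaquettes `p, q, r` of `ℤ⁴` (all first and third moments vanish). -/
theorem su2_threePoint_zero {ν : Measure (LGConfig 4 (Matrix.specialUnitaryGroup (Fin 2) ℂ))}
    (hν : ν ∈ ymGibbsMeasures (d := 4) (fundamentalRep (Fin 2)) 0) (p q r : ZdPlaquette 4) :
    cov[fun U => (W∗ p) U * (W∗ q) U, W∗ r; ν] - (∫ U, (W∗ p) U ∂ν) * cov[W∗ q, W∗ r; ν] -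
      (∫ U, (W∗ q) U ∂ν) * cov[W∗ p, W∗ r; ν] = 0 := by
  haveI : IsProbabilityMeasure ν := hν.1
  obtain ⟨-, hpm, hp1, -, -⟩ := CouplingResponse.su2_plaquetteObs_data p
  obtain ⟨-, hqm, hq1, -, -⟩ := CouplingResponse.su2_plaquetteObs_data q
  obtain ⟨-, hrm, hr1, -, -⟩ := CouplingResponse.su2_plaquetteObs_data r
  rw [CouplingResponse.threePoint_eq_moments hpm hqm hrm hp1 hq1 hr1, su2_integral_plaquette_triple_zero hν,
    su2_plaquette_zero hν p, su2_plaquette_zero hν q, su2_plaquette_zero hν r]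
  ring

/-- Local shorthand: the planes `{(i, j) : i < j}` of `ℤ⁴`. -/
local notation3 (prettyPrint := false) "𝔓₄" => {q : Fin 4 × Fin 4 // q.1 < q.2}

/-- **The third response vanishes at `β = 0`**: `Σ_{i<j} 4·(2·Σ_q Σ_r u₃(W_{p_ij}; W_q; W_r)_ν) = 0` for `ν ∈ 𝒢(0)`. -/
theorem su2_thirdResponse_zero {ν : Measure (LGConfig 4 (Matrix.specialUnitaryGroup (Fin 2) ℂ))}
    (hν : ν ∈ ymGibbsMeasures (d := 4) (fundamentalRep (Fin 2)) 0) :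
    ∑ q : 𝔓₄, 4 * (2 * ∑' s : ZdPlaquette 4, ∑' r : ZdPlaquette 4,
        (cov[fun U => (W∗ ((0 : Literature.Probability.LatticeModels.Site 4), q)) U * (W∗ s) U, W∗ r; ν] -
          (∫ U, (W∗ ((0 : Literature.Probability.LatticeModels.Site 4), q)) U ∂ν) * cov[W∗ s, W∗ r; ν] -
          (∫ U, (W∗ s) U ∂ν) * cov[W∗ ((0 : Literature.Probability.LatticeModels.Site 4), q), W∗ r; ν])) = 0 := by
  refine Finset.sum_eq_zero fun q _ => ?_
  have h := fun s r => su2_threePoint_zero hν ((0 : Literature.Probability.LatticeModels.Site 4), q) s r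
  rw [(tsum_congr fun s => (tsum_congr fun r => h s r).trans tsum_zero).trans tsum_zero]
  ring

end ZeroFlip

/-! ### `f'''(0) = 0` two-sided and `C³` on the two-sided window -/

section TwoSidedC3

open Summit.Ventures.YMGap.CouplingResponse (exists_dlrSelection)

/-- Local shorthand: the planes `{(i, j) : i < j}` of `ℤ⁴`. -/
local notation3 (prettyPrint := false) "𝔓₄" => {q : Fin 4 × Fin 4 // q.1 < q.2}

/-- Local shorthand: the normalised plaquette observable `W_q = ½ Re tr U_q` of `SU(2)` on `ℤ⁴`. -/
local notation3 (prettyPrint := false) "W∗" q:max =>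
  zdPlaquetteObs (d := 4) (fundamentalRep (Fin 2)) (Prod.fst q) (Prod.snd q).1.1 (Prod.snd q).1.2

/-- Local shorthand: the third response `R₃(ν) = Σ_{i<j} 4·(2·Σ_q Σ_r u₃(W_{p_ij}; W_q; W_r)_ν)` of a state `ν`. -/
local notation3 (prettyPrint := false) "R₃[" ν "]" => ∑ q : 𝔓₄, 4 * (2 * ∑' s : ZdPlaquette 4, ∑' r : ZdPlaquette 4,
    (cov[fun U => (W∗ ((0 : Literature.Probability.LatticeModels.Site 4), q)) U * (W∗ s) U, W∗ r; ν] -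
      (∫ U, (W∗ ((0 : Literature.Probability.LatticeModels.Site 4), q)) U ∂ν) * cov[W∗ s, W∗ r; ν] -
      (∫ U, (W∗ s) U ∂ν) * cov[W∗ ((0 : Literature.Probability.LatticeModels.Site 4), q), W∗ r; ν]))

/-- A tree-coupling DLR selection: `ν t ∈ 𝒢(t)` for every real `t` (from g8's `exists_dlrSelection`). -/
theorem su2_exists_dlrSelection_all :
    ∃ ν : ℝ → Measure (LGConfig 4 (Matrix.specialUnitaryGroup (Fin 2) ℂ)),
      ∀ t : ℝ, ν t ∈ ymGibbsMeasures (d := 4) (fundamentalRep (Fin 2)) t := by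
  obtain ⟨μ, hμ⟩ := exists_dlrSelection
  refine ⟨fun t => μ (2 * t), fun t => ?_⟩
  have h := hμ (2 * t)
  rwa [show (2 : ℝ) * (2 * t / 4) = t by ring] at h

/-- **Evenness of `f''` on the punctured window**: `f''(-t) = f''(t)` for `0 < t < 9/50` (g9's parts 2 and 8: both equal the
plaquette susceptibility of THE state at `t`). -/
theorem su2_deriv_deriv_freeEnergyDensity_neg {t : ℝ} (ht : t ∈ Ioo (0 : ℝ) (9 / 50)) :
    deriv (deriv (freeEnergyDensity 4 (fundamentalRep (Fin 2)))) (-t) =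
      deriv (deriv (freeEnergyDensity 4 (fundamentalRep (Fin 2)))) t := by
  obtain ⟨ν, hν⟩ := su2_exists_dlrSelection_all
  rw [(su2_hasDerivAt_deriv_freeEnergyDensity_neg (fun b _ => hν b) ht).deriv,
    su2_deriv_deriv_freeEnergyDensity_eq ht (hν t)]

/-- **`f'''` at NEGATIVE couplings**: for `0 < t < 9/50` and any tree-coupling DLR selection `ν` on `[0, 9/50]`,
`HasDerivAt f'' (-R₃(ν t)) (-t)` — `f''` is even near `-t`; chain rule with part 1 at `t`. -/
theorem su2_hasDerivAt_deriv_deriv_freeEnergyDensity_of_neg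
    {ν : ℝ → Measure (LGConfig 4 (Matrix.specialUnitaryGroup (Fin 2) ℂ))}
    (hν : ∀ β ∈ Icc (0 : ℝ) (9 / 50), ν β ∈ ymGibbsMeasures (d := 4) (fundamentalRep (Fin 2)) β)
    {t : ℝ} (ht : t ∈ Ioo (0 : ℝ) (9 / 50)) :
    HasDerivAt (deriv (deriv (freeEnergyDensity 4 (fundamentalRep (Fin 2))))) (-R₃[ν t]) (-t) := by
  set F : ℝ → ℝ := deriv (deriv (freeEnergyDensity 4 (fundamentalRep (Fin 2)))) with hF
  have hev : F =ᶠ[𝓝 (-t)] fun s => F (-s) := by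
    filter_upwards [Ioo_mem_nhds (show (-(9 / 50) : ℝ) < -t by linarith [ht.2]) (show -t < (0 : ℝ) by linarith [ht.1])]
      with s hs
    have hs' : -s ∈ Ioo (0 : ℝ) (9 / 50) := ⟨by linarith [hs.2], by linarith [hs.1]⟩
    have h := su2_deriv_deriv_freeEnergyDensity_neg hs'
    rw [neg_neg] at h
    rw [hF]
    exact h
  have hinner : HasDerivAt (fun s : ℝ => -s) (-1 : ℝ) (-t) := by simpa using hasDerivAt_neg (-t)
  have hpos : HasDerivAt F (R₃[ν t]) ((fun s : ℝ => -s) (-t)) := by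
    rw [show (fun s : ℝ => -s) (-t) = t by simp]
    exact su2_hasDerivAt_deriv_deriv_freeEnergyDensity hν ht
  have hcomp := HasDerivAt.comp (-t) hpos hinner
  have h2 : HasDerivAt (fun s => F (-s)) (-R₃[ν t]) (-t) := by
    refine hcomp.congr_deriv ?_; ring
  exact h2.congr_of_eventuallyEq hev

/-- ★★ **`f'''(0) = 0`, TWO-SIDED**: `f'' = deriv (deriv f)` is differentiable AT `β = 0` with derivative `0`.  Right side:
on `(0, 9/50)`, `(f'')' = R₃` (part 1) with `R₃ → R₃(0) = 0` (`su2_continuousOn_thirdResponse`, `su2_thirdResponse_zero`) and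
`f''` continuous from the right at `0` (`f''(0) = 6` two-sided, g9); left side: by evenness `(f'')'(-t) = -R₃(t) → 0`; both
one-sided derivatives exist by the limit-of-derivatives extension (`hasDerivWithinAt_Ici/Iic_of_tendsto_deriv`) and agree. -/
theorem su2_hasDerivAt_deriv_deriv_freeEnergyDensity_zero :
    HasDerivAt (deriv (deriv (freeEnergyDensity 4 (fundamentalRep (Fin 2))))) (0 : ℝ) 0 := by
  classical
  obtain ⟨ν, hν⟩ := su2_exists_dlrSelection_all
  have hνsel : ∀ t ∈ Icc (0 : ℝ) (9 / 50), ν t ∈ ymGibbsMeasures (d := 4) (fundamentalRep (Fin 2)) t := fun t _ => hν t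
  set F : ℝ → ℝ := deriv (deriv (freeEnergyDensity 4 (fundamentalRep (Fin 2)))) with hF
  set S : ℝ → ℝ := fun t => ∑ q : 𝔓₄, 4 * ∑' r : ZdPlaquette 4,
    cov[zdPlaquetteObs (fundamentalRep (Fin 2)) 0 q.1.1 q.1.2,
      zdPlaquetteObs (fundamentalRep (Fin 2)) r.1 r.2.1.1 r.2.1.2; ν t] with hS
  set R : ℝ → ℝ := fun t => R₃[ν t] with hR
  have hR0 : R 0 = 0 := su2_thirdResponse_zero (hν 0)
  have hS0 : S 0 = 6 := by
    simp only [hS]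
    rw [Finset.sum_congr rfl fun q _ => by
        rw [su2_responseSum_zero (hν 0) ((0 : Literature.Probability.LatticeModels.Site 4), q)],
      Finset.sum_const, Finset.card_univ, nsmul_eq_mul]
    have hcard : (Fintype.card 𝔓₄ : ℝ) = 6 := by
      rw [Fintype.card_subtype]; norm_cast
    rw [hcard]; norm_num
  have hF0 : F 0 = 6 := su2_hasDerivAt_deriv_freeEnergyDensity_zero.deriv
  have hFS : ∀ t ∈ Ioo (0 : ℝ) (9 / 50), F t = S t := fun t ht => su2_deriv_deriv_freeEnergyDensity_eq ht (hν t)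
  have hdpos : ∀ t ∈ Ioo (0 : ℝ) (9 / 50), HasDerivAt F (R t) t := fun t ht =>
    su2_hasDerivAt_deriv_deriv_freeEnergyDensity hνsel ht
  have hdneg : ∀ t ∈ Ioo (-(9 / 50) : ℝ) 0, HasDerivAt F (-R (-t)) t := by
    intro t ht
    have h := su2_hasDerivAt_deriv_deriv_freeEnergyDensity_of_neg hνsel (t := -t) ⟨by linarith [ht.2], by linarith [ht.1]⟩
    rw [neg_neg] at h
    exact h
  have hScont := su2_continuousOn_susceptibility hνsel
  have hRcont : ContinuousOn R (Icc (0 : ℝ) (9 / 50)) := su2_continuousOn_thirdResponse hνsel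
  have hmaps : MapsTo (fun t : ℝ => -t) (Icc (-(9 / 50) : ℝ) 0) (Icc (0 : ℝ) (9 / 50)) :=
    fun t ht => ⟨by linarith [ht.2], by linarith [ht.1]⟩
  -- right derivative at `0`
  have hA : HasDerivWithinAt F 0 (Ici (0 : ℝ)) 0 := by
    have hdiff : DifferentiableOn ℝ F (Ioo (0 : ℝ) (9 / 50)) := fun t ht =>
      (hdpos t ht).differentiableAt.differentiableWithinAt
    have hcont : ContinuousWithinAt F (Ioo (0 : ℝ) (9 / 50)) 0 := by
      have hSc : ContinuousWithinAt S (Ioo (0 : ℝ) (9 / 50)) 0 :=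
        (hScont 0 ⟨le_rfl, by norm_num⟩).mono Ioo_subset_Icc_self
      refine hSc.congr_of_eventuallyEq (eventually_nhdsWithin_of_forall fun t ht => hFS t ht) ?_
      rw [hF0, hS0]
    have hlim : Tendsto (fun t => deriv F t) (𝓝[>] 0) (𝓝 0) := by
      have h := ((hRcont 0 ⟨le_rfl, by norm_num⟩).mono Ioo_subset_Icc_self).tendsto
      rw [hR0, nhdsWithin_Ioo_eq_nhdsGT (show (0 : ℝ) < 9 / 50 by norm_num)] at h
      refine h.congr' ?_
      filter_upwards [Ioo_mem_nhdsGT (show (0 : ℝ) < 9 / 50 by norm_num)] with t ht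
      exact (hdpos t ht).deriv.symm
    exact hasDerivWithinAt_Ici_of_tendsto_deriv hdiff hcont (Ioo_mem_nhdsGT (by norm_num)) hlim
  -- left derivative at `0`
  have hB : HasDerivWithinAt F 0 (Iic (0 : ℝ)) 0 := by
    have hdiff : DifferentiableOn ℝ F (Ioo (-(9 / 50) : ℝ) 0) := fun t ht =>
      (hdneg t ht).differentiableAt.differentiableWithinAt
    have hcont : ContinuousWithinAt F (Ioo (-(9 / 50) : ℝ) 0) 0 := by
      have hSc : ContinuousWithinAt (fun t => S (-t)) (Ioo (-(9 / 50) : ℝ) 0) 0 :=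
        ((hScont.comp continuous_neg.continuousOn hmaps) 0 ⟨by norm_num, le_rfl⟩).mono Ioo_subset_Icc_self
      refine hSc.congr_of_eventuallyEq (eventually_nhdsWithin_of_forall fun t ht => ?_) ?_
      · have ht' : -t ∈ Ioo (0 : ℝ) (9 / 50) := ⟨by linarith [ht.2], by linarith [ht.1]⟩
        show F t = S (-t)
        rw [← hFS (-t) ht', hF]
        have h := su2_deriv_deriv_freeEnergyDensity_neg ht'
        rw [neg_neg] at h
        exact h
      · show F 0 = S (-0)
        rw [neg_zero, hF0, hS0]
    have hlim : Tendsto (fun t => deriv F t) (𝓝[<] 0) (𝓝 0) := by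
      have hRc : ContinuousWithinAt (fun t => -R (-t)) (Icc (-(9 / 50) : ℝ) 0) 0 :=
        ((hRcont.comp continuous_neg.continuousOn hmaps) 0 ⟨by norm_num, le_rfl⟩).neg
      have h := (hRc.mono Ioo_subset_Icc_self).tendsto
      have h0 : -R (-0) = 0 := by rw [neg_zero, hR0, neg_zero]
      rw [h0, nhdsWithin_Ioo_eq_nhdsLT (show (-(9 / 50) : ℝ) < 0 by norm_num)] at h
      refine h.congr' ?_
      filter_upwards [Ioo_mem_nhdsLT (show (-(9 / 50) : ℝ) < 0 by norm_num)] with t ht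
      exact (hdneg t ht).deriv.symm
    exact hasDerivWithinAt_Iic_of_tendsto_deriv hdiff hcont (Ioo_mem_nhdsLT (by norm_num)) hlim
  simpa using hB.union hA

/-- **`deriv³ f (0) = 0`**: the cubic Taylor coefficient of the free energy density at infinite temperature vanishes. -/
theorem su2_deriv_deriv_deriv_freeEnergyDensity_zero :
    deriv (deriv (deriv (freeEnergyDensity 4 (fundamentalRep (Fin 2))))) 0 = 0 :=
  su2_hasDerivAt_deriv_deriv_freeEnergyDensity_zero.deriv

/-- **`f''` is differentiable at every point of the two-sided window** `(-9/50, 9/50)`. -/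
theorem su2_differentiableOn_deriv_deriv_freeEnergyDensity_abs :
    DifferentiableOn ℝ (deriv (deriv (freeEnergyDensity 4 (fundamentalRep (Fin 2))))) (Ioo (-(9 / 50) : ℝ) (9 / 50)) := by
  obtain ⟨ν, hν⟩ := su2_exists_dlrSelection_all
  have hνsel : ∀ t ∈ Icc (0 : ℝ) (9 / 50), ν t ∈ ymGibbsMeasures (d := 4) (fundamentalRep (Fin 2)) t := fun t _ => hν t
  intro t ht
  rcases lt_trichotomy t 0 with hneg | rfl | hpos
  · have h := su2_hasDerivAt_deriv_deriv_freeEnergyDensity_of_neg hνsel (t := -t) ⟨by linarith, by linarith [ht.1]⟩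
    rw [neg_neg] at h
    exact h.differentiableAt.differentiableWithinAt
  · exact su2_hasDerivAt_deriv_deriv_freeEnergyDensity_zero.differentiableAt.differentiableWithinAt
  · exact (su2_hasDerivAt_deriv_deriv_freeEnergyDensity hνsel ⟨hpos, ht.2⟩).differentiableAt.differentiableWithinAt

/-- **`f'''` is continuous on the open two-sided window** (`= R₃` on the right, `-R₃ ∘ neg` on the left, `0` at `0`). -/
theorem su2_continuousOn_deriv_deriv_deriv_freeEnergyDensity_abs :
    ContinuousOn (deriv (deriv (deriv (freeEnergyDensity 4 (fundamentalRep (Fin 2))))))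
      (Ioo (-(9 / 50) : ℝ) (9 / 50)) := by
  classical
  obtain ⟨ν, hν⟩ := su2_exists_dlrSelection_all
  have hνsel : ∀ t ∈ Icc (0 : ℝ) (9 / 50), ν t ∈ ymGibbsMeasures (d := 4) (fundamentalRep (Fin 2)) t := fun t _ => hν t
  set F : ℝ → ℝ := deriv (deriv (freeEnergyDensity 4 (fundamentalRep (Fin 2)))) with hF
  set R : ℝ → ℝ := fun t => R₃[ν t] with hR
  have hR0 : R 0 = 0 := su2_thirdResponse_zero (hν 0)
  have hRcont : ContinuousOn R (Icc (0 : ℝ) (9 / 50)) := su2_continuousOn_thirdResponse hνsel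
  have hmaps : MapsTo (fun t : ℝ => -t) (Icc (-(9 / 50) : ℝ) 0) (Icc (0 : ℝ) (9 / 50)) :=
    fun t ht => ⟨by linarith [ht.2], by linarith [ht.1]⟩
  have hRneg : ContinuousOn (fun t => -R (-t)) (Icc (-(9 / 50) : ℝ) 0) :=
    (hRcont.comp continuous_neg.continuousOn hmaps).neg
  have hpos : ∀ t ∈ Ioo (0 : ℝ) (9 / 50), deriv F t = R t := fun t ht =>
    (su2_hasDerivAt_deriv_deriv_freeEnergyDensity hνsel ht).deriv
  have hneg : ∀ t ∈ Ioo (-(9 / 50) : ℝ) 0, deriv F t = -R (-t) := by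
    intro t ht
    have h := su2_hasDerivAt_deriv_deriv_freeEnergyDensity_of_neg hνsel (t := -t) ⟨by linarith [ht.2], by linarith [ht.1]⟩
    rw [neg_neg] at h
    exact h.deriv
  have h0 : deriv F 0 = 0 := su2_deriv_deriv_deriv_freeEnergyDensity_zero
  refine continuousOn_of_forall_continuousAt fun t ht => ?_
  rcases lt_trichotomy t 0 with hlt | rfl | hgt
  · have hc : ContinuousAt (fun s => -R (-s)) t := hRneg.continuousAt (Icc_mem_nhds ht.1 hlt)
    refine hc.congr ?_
    filter_upwards [Ioo_mem_nhds ht.1 hlt] with s hs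
    exact (hneg s hs).symm
  · rw [continuousAt_iff_continuous_left_right]
    constructor
    · rw [← continuousWithinAt_Iio_iff_Iic]
      have h := ((hRneg 0 ⟨by norm_num, le_rfl⟩).mono Ioo_subset_Icc_self).tendsto
      have e0 : -R (-0) = deriv F 0 := by rw [neg_zero, hR0, neg_zero, h0]
      rw [e0, nhdsWithin_Ioo_eq_nhdsLT (show (-(9 / 50) : ℝ) < 0 by norm_num)] at h
      refine h.congr' ?_
      filter_upwards [Ioo_mem_nhdsLT (show (-(9 / 50) : ℝ) < 0 by norm_num)] with s hs
      exact (hneg s hs).symm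
    · rw [← continuousWithinAt_Ioi_iff_Ici]
      have h := ((hRcont 0 ⟨le_rfl, by norm_num⟩).mono Ioo_subset_Icc_self).tendsto
      have e0 : R 0 = deriv F 0 := by rw [hR0, h0]
      rw [e0, nhdsWithin_Ioo_eq_nhdsGT (show (0 : ℝ) < 9 / 50 by norm_num)] at h
      refine h.congr' ?_
      filter_upwards [Ioo_mem_nhdsGT (show (0 : ℝ) < 9 / 50 by norm_num)] with s hs
      exact (hpos s hs).symm
  · have hc : ContinuousAt R t := hRcont.continuousAt (Icc_mem_nhds hgt ht.2)
    refine hc.congr ?_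
    filter_upwards [Ioo_mem_nhds hgt ht.2] with s hs
    exact (hpos s hs).symm

/-- `ContDiffOn ℝ 1` on an open interval from a derivative continuous on the OPEN interval. [folklore] -/
theorem contDiffOn_one_of_hasDerivAt_Ioo {Φ g : ℝ → ℝ} {a c : ℝ}
    (hderiv : ∀ t ∈ Ioo a c, HasDerivAt Φ (g t) t) (hg : ContinuousOn g (Ioo a c)) :
    ContDiffOn ℝ 1 Φ (Ioo a c) := by
  rw [show (1 : WithTop ℕ∞) = 0 + 1 from (zero_add 1).symm, contDiffOn_succ_iff_deriv_of_isOpen isOpen_Ioo]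
  refine ⟨fun t ht => (hderiv t ht).differentiableAt.differentiableWithinAt, fun h => ?_, ?_⟩
  · exact absurd h (by simp)
  · rw [contDiffOn_zero]
    exact hg.congr fun t ht => (hderiv t ht).deriv

/-- ★★ **`f ∈ C³` ON THE WHOLE TWO-SIDED WINDOW `(-9/50, 9/50)`** (`|β_W| < 9/25`), THROUGH `β = 0`:
`ContDiffOn ℝ 3 (freeEnergyDensity 4 ρ_{SU(2)}) (Ioo (-9/50) (9/50))` — no transition of order `≤ 3` anywhere in the two-sided
strong-coupling window, as a kernel theorem about the thermodynamic potential. -/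
theorem su2_contDiffOn_three_freeEnergyDensity_abs :
    ContDiffOn ℝ 3 (freeEnergyDensity 4 (fundamentalRep (Fin 2))) (Ioo (-(9 / 50) : ℝ) (9 / 50)) := by
  have h2 := su2_contDiffOn_two_freeEnergyDensity_abs
  rw [show (2 : WithTop ℕ∞) = 1 + 1 from rfl, contDiffOn_succ_iff_deriv_of_isOpen isOpen_Ioo] at h2
  obtain ⟨hd1, -, h1⟩ := h2
  rw [show (1 : WithTop ℕ∞) = 0 + 1 from (zero_add 1).symm, contDiffOn_succ_iff_deriv_of_isOpen isOpen_Ioo] at h1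
  obtain ⟨hd2, -, -⟩ := h1
  rw [show (3 : WithTop ℕ∞) = 2 + 1 from rfl, contDiffOn_succ_iff_deriv_of_isOpen isOpen_Ioo]
  refine ⟨hd1, fun h => absurd h (by simp), ?_⟩
  rw [show (2 : WithTop ℕ∞) = 1 + 1 from rfl, contDiffOn_succ_iff_deriv_of_isOpen isOpen_Ioo]
  refine ⟨hd2, fun h => absurd h (by simp), ?_⟩
  refine contDiffOn_one_of_hasDerivAt_Ioo (g := deriv (deriv (deriv (freeEnergyDensity 4 (fundamentalRep (Fin 2))))))
    (fun t ht => ?_) su2_continuousOn_deriv_deriv_deriv_freeEnergyDensity_abs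
  exact ((su2_differentiableOn_deriv_deriv_freeEnergyDensity_abs t ht).differentiableAt (Ioo_mem_nhds ht.1 ht.2)).hasDerivAt

/-- ★★ **Wilson normalisation, two-sided**: `g(β_W) := f(β_W/2)` is `C³` on `|β_W| < 9/25 = 0.36`; with g9's `g'(0) = -6`,
`g''(0) = 3/2` and `f'''(0) = 0`: `g(β_W) = -6β_W + (3/4)β_W² + 0·β_W³ + o(β_W³)`. -/
theorem su2_wilson_contDiffOn_three_abs :
    ContDiffOn ℝ 3 (fun βW : ℝ => freeEnergyDensity 4 (fundamentalRep (Fin 2)) (βW / 2)) (Ioo (-(9 / 25) : ℝ) (9 / 25)) :=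
  su2_contDiffOn_three_freeEnergyDensity_abs.comp (contDiff_id.div_const (2 : ℝ)).contDiffOn
    fun b hb => ⟨by linarith [hb.1], by linarith [hb.2]⟩

end TwoSidedC3

end Summit.Ventures.YMGap.PressureRegularity

end
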